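import Summits.ValiantsHypothesis.ValiantsHypothesis.Theses.FreeSubtorus
import Literature.Computability.AlgebraicComplexity.GrenetEquivariant
import Literature.Computability.AlgebraicComplexity.LRPencilOfMatrix
import Literature.Computability.AlgebraicComplexity.LandsbergRessayreProofs
import Literature.Computability.AlgebraicComplexity.AlperBogartVelascoProofs
import Literature.Computability.AlgebraicComplexity.RankOneDeterminantalExpressionsProofs
import Literature.Computability.AlgebraicComplexity.PermanentVsDeterminantProofs
import Summits.ValiantsHypothesis.ValiantsHypothesis.Theorems.RigidMinimalRepsTorusBound

/-!
# Disproof work file for `FreeSubtorus.OrbitDimensionBound` (crux stmt-ValiantsHypothesis-16133)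

Standing disprover `refuter-cdisprove-stmt-ValiantsHypothesis-16133`, cycle 1 (2026-08-17).
Crux BY NAME: `Summit.ValiantsHypothesis.ValiantsHypothesis.Theses.FreeSubtorus.OrbitDimensionBound`
— for `n ≥ 3` and every `m`: if `per_n` has an affine determinantal representation of size `m`, then
it has one of the SAME size that is equivariant (exact `GL_m × GL_m` lifts) under the subtorus
`T_Λ = closure {diag(d_k e_l) : Π d^{Λ_i(inl ·)} Π e^{Λ_i(inr ·)} = 1 ∀ i}` for some `r ≤ n/2`
ADMISSIBLE relations (zero row-sums and column-sums).

## Findings (all theorems below are kernel-checked unless marked `sorry`; none is)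

* **VERDICT: no kill; the crux resists because it has no decidable instance.**  `B` is not tied to
  `A`, so (padding `B ⊕ 1`) the crux says exactly: for every `n ≥ 3`, `dc(per_n)` is attained by an
  admissibly half-torus-symmetric representation.  Its conclusion is TRUE for all `m ≥ 2ⁿ − 1`
  (Grenet's representation is two-sided-torus equivariant with exact lifts, tree
  `Grenet.isEquivariantDetRepr_repr`, `r = 0`) and VACUOUS for `m < dc(per_n)`; with
  `dc(per₃) = 7 = 2³ − 1` (tree, Alper–Bogart–Velasco) the slice `n = 3` is provable outright (done
  by the vetting refuter, Evidence.lean on the item).  Content lives only at `n ≥ 4`,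
  `dc(per_n) ≤ m ≤ 2ⁿ − 2` (`9 ≤ dc(per₄) ≤ 15`, tree); no representation of any `per_n`, `n ≥ 4`,
  smaller than Grenet's is known (Hüttenhain–Ikenmeyer 2016 §1: "determining `bdc(per₄)` is
  currently out of reach"), so no counterexample search is possible: a refutation needs a NEW
  sub-Grenet representation of some `per_n` plus an `edc` lower bound for every admissible `T_Λ`.
* §1 **Reduction to the optimal size** (`orbitDimensionBound_iff_optimal`, with the padding lemma
  `isEquivariantDetRepr_padMat`): the crux ⟺ `∀ n ≥ 3, Concl n (dc(per_n))`; a refutation needs an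
  optimal-size gap at ONE `n` (`not_orbitDimensionBound_of_optimal_gap`).
* §2 **Load-bearing hypothesis.** Dropping `IsAffineDetRepr (per_n) A` (asking the conclusion at
  every size) is false already at `(n, m) = (3, 6)` (`orbitDimensionBound_false_without_repHyp`,
  via `dc(per₃) ≥ 7`).  `3 ≤ n` is NOT load-bearing (conclusion holds at `n = 1, 2`; it is there
  for the sibling `SubtorusCovering`).  `r ≤ n/2` and admissibility are strength knobs, not
  hypotheses: no `Λ` can make `T_Λ` small (`dim T_Λ ≥ 2n − r`), and EVERY admissible `T_Λ`
  contains all homotheties `x ↦ c·x` (`homothety_mem_TΛ`).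
* §3 **Necessary condition (any proof must deliver it).** `OrbitDimensionBound` ⇒
  `HomothetySymmetrisation`: at every size `m ≥ dc(per_n)` some representation admits exact lifts
  of all homotheties (`homothetySymmetrisation_of_orbitDimensionBound`; contrapositive
  `orbitDimensionBound_false_of_not_homothetySymmetrisation`).  Open by itself for `n ≥ 4`.
* §4 **Natural strengthenings REFUTED (sorry-free): symmetry cannot be imposed IN PLACE.**  The
  Koszul-twisted Grenet matrix `A = (1+V)·G₇·(1+U)` (`twistedGrenet`, the witness that refuted
  `UlrichPadded.NoTightInfinity`, stmt-5668) is an affine determinantal representation of `per₃`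
  of the OPTIMAL size `7` (`isAffineDetRepr_twistedGrenet`) which admits NO exact lift of the
  homothety `x ↦ 2x` (`twistedGrenet_no_homothety_lift`: five scalar coefficient identities force
  row `0` of `g` to vanish).  Hence (`not_inPlaceHomothety`, `not_inPlaceModAdmissible`,
  `not_orbitDimensionBoundInPlace`): "every representation is ITSELF `T_Λ`-equivariant for some
  admissible `Λ`" is false for EVERY rank `r` (not just `r ≤ n/2`), at `(n, m) = (3, dc(per₃))`.
  Exact-arithmetic side computation (folder `py/liftlie.py`): the exact-lift group of `A` in
  `(ℂˣ)³ × (ℂˣ)³` has dimension `4` (Grenet: `6`), Lie algebra `ker χ₁ ∩ ker χ₂` with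
  `χ₁ = d₀d₁⁻¹d₂⁻¹e₂⁻¹`, `χ₂ = e₀e₂⁻¹`; `χ₁` has row-sum `−1`, so NO admissible lattice of any rank
  has `T_Λ ⊆ Lift(A)` — consistent with the theorem.  MORAL for provers: the `B` of the crux must
  differ from `A` by a NON-CONSTANT gauge (`A` and `G₇` are `GL₇(ℂ[x])`-equivalent, not
  `GL₇(ℂ)²`-equivalent); lines that read symmetry off `A` itself are dead, lines that pass to an
  initial form / closed orbit (Sketch stub 2, birth stub 2) are consistent with this obstruction
  (the initial form of `A` along its grading cocharacter is `G₇`, fully torus-symmetric).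
* §5 **`r = 0` strengthening** (full two-sided torus at every size `≥ dc`): implies the crux
  (`orbitDimensionBound_of_r0`) and is EQUIVALENT, kernel-checked, to Grenet-optimality
  `∀ n ≥ 3, dc(per_n) = 2ⁿ − 1` (`orbitDimensionBoundR0_iff_grenetOptimal`, via the PROVED sibling-route
  item `RigidMinimalReps.TorusBound`, stmt-5114, and Grenet + padding); e.g. it forces
  `dc(per₄) = 15` (`dc_per4_eq_of_r0`).  TRUE at `n = 3`, open from `n = 4` on; not refutable today.
* §6 **Targets (lines `Sketch`, PICKED 2026-08-17, and `birth`).** No stub is false as typed: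
  Sketch stub 1 (`stub_tightModLatticeLifts`) TRUE (diagonal lifts `diag χ_{α i}(t)`, `diag χ_{β j}(t)`;
  `of_generators`); Sketch stub 2 (`stub_initialFormAccumulates`) TRUE (Białynicki-Birula:
  `A_s = diag(s^{-a}) A(s^μ x) diag(s^{-b})` is polynomial in `s` with `det A_s = per_n` for `s ≠ 0`,
  so `det A_0 = per_n`); Sketch stub 3 (`stub_smallFace`) ≡ crux modulo torus diagonalisation —
  open, VH-strength; its in-place variant is NOT killed by §4 (the BB step of stub 2 turns the
  twisted Grenet back into Grenet).  birth stubs 2–3 are true GIT (closed orbit in an orbit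
  closure; Derksen–Makam invariants separate closed `SL₇²`-orbits), stub 1 ≡ crux.  0 targets broken.

## Landed under `Theorems/OrbitDimensionBound/Negative/` (importable; namespace
`Summit.ValiantsHypothesis.Theorems.OrbitDimensionBoundNegative`)
* `FalseWithoutRepHyp.lean` (p160661, ACCEPTED): `orbitDimensionBound_false_without_repHyp`.
* `InPlaceFalse.lean` (p162351, ACCEPTED): `exists_repr_per3_without_homothety_lift`,
  `not_inPlaceHomothety`, `homothety_two_mem_closure`, `not_inPlaceModAdmissible`,
  `not_orbitDimensionBound_inPlace`, `orbitDimensionBound_of_inPlace`.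
* `HomothetyReduction.lean` (p165370, ACCEPTED): `scalar_mem_admissibleClosure`,
  `homothetyLifts_of_orbitDimensionBound`, `not_orbitDimensionBound_of_homothetyGap`.
* `R0IffGrenetOptimal.lean` (p166677, dry-run ACCEPT, pending): `isEquivariantDetRepr_pad`,
  `orbitDimensionBound_r0_iff_grenetOptimal`, `orbitDimensionBound_of_r0`, `not_r0_of_subGrenet`.

## What a refutation would need (for the next disprover)
An explicit affine representation of some `per_n` (`n ≥ 4`) of size `m ≤ 2ⁿ − 2` — new mathematics
(first candidate: `per₄`, `9 ≤ m ≤ 14`; HI16 could not settle even the binary case) — AND a proof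
that no size-`m` representation is `T_Λ`-equivariant for any admissible `Λ`, `r ≤ n/2` (an
LR/Odlyzko-type graded count; printed only for the left-monomial group, tree
`lr_left_equivariant_lower_holds`).  Kill switch shared with the route: any `dc(per_n) <
C(n,⌊n/2⌋)/2^{⌊n/2⌋}` (first biting `n ≈ 22`) refutes `OrbitDimensionBound ∧ SubtorusCovering`.
-/

noncomputable section

namespace Summit.ValiantsHypothesis.ValiantsHypothesis.Cruxes.OrbitDimensionBound.Disproof

open MvPolynomial Matrix
open Literature.Computability.AlgebraicComplexity LRPencil
open Summit.ValiantsHypothesis.ValiantsHypothesis.Theses.FreeSubtorus (OrbitDimensionBound)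

-- `Summit.ValiantsHypothesis.ValiantsHypothesis.…` is the tree's mandated layout (Sub = Summit).
set_option linter.dupNamespace false

/-! ## §1 The crux, read back -/

/-- The crux's symmetry group: the subtorus `T_Λ` of the two-sided torus cut out by the `r`
character relations `Λ` (generator form, verbatim from the route file). [folklore] -/
def TΛ (n r : ℕ) (Λ : Fin r → (Fin n ⊕ Fin n) → ℤ) : Subgroup (GL (Fin n × Fin n) ℂ) :=
  Subgroup.closure {γ : Matrix.GeneralLinearGroup (Fin n × Fin n) ℂ | ∃ d e : Fin n → ℂˣ,
    (∀ i, (∏ k, (d k) ^ (Λ i (Sum.inl k))) * (∏ l, (e l) ^ (Λ i (Sum.inr l))) = 1) ∧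
    (γ : Matrix (Fin n × Fin n) (Fin n × Fin n) ℂ) =
      Matrix.diagonal (fun p => (d p.1 : ℂ) * (e p.2 : ℂ))}

/-- Admissibility of the relations: zero row-sums and zero column-sums. [folklore] -/
def Admissible (n r : ℕ) (Λ : Fin r → (Fin n ⊕ Fin n) → ℤ) : Prop :=
  ∀ i, (∑ k, Λ i (Sum.inl k)) = 0 ∧ (∑ l, Λ i (Sum.inr l)) = 0

/-- The conclusion of the crux at `(n, m)`: some size-`m` representation of `per_n` is
`T_Λ`-equivariant for an admissible `Λ` with `r ≤ n/2` relations. [folklore] -/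
def Concl (n m : ℕ) : Prop :=
  ∃ (B : Matrix (Fin m) (Fin m) (MvPolynomial (Fin n × Fin n) ℂ)) (r : ℕ)
    (Λ : Fin r → (Fin n ⊕ Fin n) → ℤ), r ≤ n / 2 ∧ Admissible n r Λ ∧
    IsEquivariantDetRepr (TΛ n r Λ) (perPoly (Fin n) ℂ) B

/-- READ-BACK (elaboration check): the crux is literally "`n ≥ 3`, a size-`m` representation exists
⇒ `Concl n m`"; `B` is not tied to `A`. [folklore] -/
theorem orbitDimensionBound_iff :
    OrbitDimensionBound ↔ ∀ n : ℕ, 3 ≤ n → ∀ (m : ℕ)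
      (A : Matrix (Fin m) (Fin m) (MvPolynomial (Fin n × Fin n) ℂ)),
      IsAffineDetRepr (perPoly (Fin n) ℂ) A → Concl n m :=
  Iff.rfl

/-! ### Reduction to the optimal size (padding) -/

section Pad

variable {k : Type*} [CommRing k] {σ : Type*} [Fintype σ] [DecidableEq σ]

/-- Block-diagonal padding `X ↦ (X ⊕ 1)` of an invertible matrix, reindexed to `Fin (m + c)`.
[folklore] -/
def padGL {m : ℕ} (c : ℕ) (g : GL (Fin m) k) : GL (Fin (m + c)) k where
  val := Matrix.reindex finSumFinEquiv finSumFinEquiv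
    (Matrix.fromBlocks (g : Matrix (Fin m) (Fin m) k) 0 0 (1 : Matrix (Fin c) (Fin c) k))
  inv := Matrix.reindex finSumFinEquiv finSumFinEquiv
    (Matrix.fromBlocks ((g⁻¹ : GL (Fin m) k) : Matrix (Fin m) (Fin m) k) 0 0 (1 : Matrix (Fin c) (Fin c) k))
  val_inv := by
    rw [Matrix.reindex_apply, Matrix.reindex_apply, Matrix.submatrix_mul_equiv,
      Matrix.fromBlocks_multiply]
    simp [Matrix.fromBlocks_one, Matrix.submatrix_one_equiv]
  inv_val := by
    rw [Matrix.reindex_apply, Matrix.reindex_apply, Matrix.submatrix_mul_equiv,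
      Matrix.fromBlocks_multiply]
    simp [Matrix.fromBlocks_one, Matrix.submatrix_one_equiv]

/-- The padded matrix `B ⊕ 1_c`, reindexed to `Fin (m + c)`. [folklore] -/
def padMat {R : Type*} [Zero R] [One R] {m : ℕ} (c : ℕ) (B : Matrix (Fin m) (Fin m) R) :
    Matrix (Fin (m + c)) (Fin (m + c)) R :=
  Matrix.reindex finSumFinEquiv finSumFinEquiv (Matrix.fromBlocks B 0 0 (1 : Matrix (Fin c) (Fin c) R))

omit [Fintype σ] [DecidableEq σ] in
/-- Padding preserves being an affine determinantal representation (`HasDetRepr.mono_holds`).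
[cite: MignonRessayre2004, §1] -/
theorem isAffineDetRepr_padMat {f : MvPolynomial σ k} {m : ℕ} {B : Matrix (Fin m) (Fin m) (MvPolynomial σ k)}
    (hB : IsAffineDetRepr f B) (c : ℕ) : IsAffineDetRepr f (padMat c B) := by
  refine ⟨fun i j => ?_, ?_⟩
  · rw [padMat, Matrix.reindex_apply, Matrix.submatrix_apply]
    generalize finSumFinEquiv.symm i = a
    generalize finSumFinEquiv.symm j = b
    rcases a with a | a <;> rcases b with b | b
    · simpa using hB.1 a b
    · simp
    · simp
    · simp only [Matrix.fromBlocks_apply₂₂, Matrix.one_apply]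
      split_ifs <;> simp
  · rw [padMat, Matrix.det_reindex_self, Matrix.det_fromBlocks_zero₂₁, Matrix.det_one, mul_one, hB.2]

/-- `padMat` commutes with entrywise ring homomorphisms fixing `0, 1`. [folklore] -/
theorem padMat_map {R S : Type*} [Semiring R] [Semiring S] {m : ℕ} (c : ℕ)
    (B : Matrix (Fin m) (Fin m) R) (φ : R →+* S) :
    (padMat c B).map φ = padMat c (B.map φ) := by
  rw [padMat, padMat, Matrix.reindex_apply, Matrix.reindex_apply, ← Matrix.submatrix_map,
    Matrix.fromBlocks_map, Matrix.map_zero _ (map_zero φ), Matrix.map_zero _ (map_zero φ),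
    Matrix.map_one _ (map_zero φ) (map_one φ)]

/-- `padMat` is multiplicative. [folklore] -/
theorem padMat_mul {R : Type*} [Semiring R] {m : ℕ} (c : ℕ) (X Y : Matrix (Fin m) (Fin m) R) :
    padMat c X * padMat c Y = padMat c (X * Y) := by
  rw [padMat, padMat, padMat, Matrix.reindex_apply, Matrix.reindex_apply, Matrix.reindex_apply,
    Matrix.submatrix_mul_equiv, Matrix.fromBlocks_multiply]
  simp

/-- **Padding preserves equivariance with exact lifts**: `B ⊕ 1_c` is `Γ`-equivariant whenever
`B` is (lift `(g ⊕ 1, h ⊕ 1)`). [cite: LandsbergRessayre2017, Def. 1.3] -/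
theorem isEquivariantDetRepr_padMat {Γ : Subgroup (GL σ k)} {f : MvPolynomial σ k} {m : ℕ}
    {B : Matrix (Fin m) (Fin m) (MvPolynomial σ k)} (hB : IsEquivariantDetRepr Γ f B) (c : ℕ) :
    IsEquivariantDetRepr Γ f (padMat c B) := by
  refine ⟨isAffineDetRepr_padMat hB.1 c, fun γ hγ => ?_⟩
  obtain ⟨g, h, hgh⟩ := hB.2 γ hγ
  refine ⟨padGL c g, padGL c h, ?_⟩
  have hL : Matrix.linSubstEntries γ (padMat c B) = padMat c (Matrix.linSubstEntries γ B) := by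
    simp only [Matrix.linSubstEntries]
    exact padMat_map c B (linSubst σ k (γ : Matrix σ σ k)).toRingHom
  have hg : ((padGL c g : GL (Fin (m + c)) k) : Matrix (Fin (m + c)) (Fin (m + c)) k).map C =
      padMat c ((g : Matrix (Fin m) (Fin m) k).map C) :=
    padMat_map c (g : Matrix (Fin m) (Fin m) k) (C : k →+* MvPolynomial σ k)
  have hh : (((padGL c h)⁻¹ : GL (Fin (m + c)) k) : Matrix (Fin (m + c)) (Fin (m + c)) k).map C =
      padMat c (((h⁻¹ : GL (Fin m) k) : Matrix (Fin m) (Fin m) k).map C) :=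
    padMat_map c ((h⁻¹ : GL (Fin m) k) : Matrix (Fin m) (Fin m) k) (C : k →+* MvPolynomial σ k)
  rw [hL, hg, hh, padMat_mul, padMat_mul, hgh]

end Pad

/-- The conclusion is monotone in the size: pad `B ↦ B ⊕ 1_c` (same `Λ`). [folklore] -/
theorem concl_mono {n m : ℕ} (h : Concl n m) (c : ℕ) : Concl n (m + c) := by
  obtain ⟨B, r, Λ, hr, hΛ, hB⟩ := h
  exact ⟨padMat c B, r, Λ, hr, hΛ, isEquivariantDetRepr_padMat hB c⟩

/-- **The crux is equivalent to its optimal-size slice**: `OrbitDimensionBound` holds iff for every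
`n ≥ 3` some representation of size EXACTLY `dc(per_n)` is admissibly half-torus symmetric.
(→: apply the crux to an optimal representation; ←: `m ≥ dc(per_n)` by minimality, then pad.)
So a refutation needs exactly: some `n ≥ 3` at which no size-`dc(per_n)` representation is
`T_Λ`-equivariant for any admissible `Λ`, `r ≤ n/2`. [folklore] -/
theorem orbitDimensionBound_iff_optimal :
    OrbitDimensionBound ↔
      ∀ n : ℕ, 3 ≤ n → Concl n (determinantalComplexity (perPoly (Fin n) ℂ)) := by
  refine ⟨fun h n hn => ?_, fun h n hn m A hA => ?_⟩
  · obtain ⟨A, hA⟩ := hasDetRepr_determinantalComplexity_holds (perPoly (Fin n) ℂ)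
    exact h n hn _ A hA
  · have hle : determinantalComplexity (perPoly (Fin n) ℂ) ≤ m :=
      determinantalComplexity_le_of_hasDetRepr ⟨A, hA⟩
    obtain ⟨c, hc⟩ := Nat.exists_eq_add_of_le hle
    rw [hc]
    exact concl_mono (h n hn) c

/-- Hence an "optimal-size gap" at a single `n ≥ 3` refutes the crux. [folklore] -/
theorem not_orbitDimensionBound_of_optimal_gap
    (h : ∃ n : ℕ, 3 ≤ n ∧ ¬ Concl n (determinantalComplexity (perPoly (Fin n) ℂ))) :
    ¬ OrbitDimensionBound := by
  obtain ⟨n, hn, hno⟩ := h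
  exact fun hO => hno (orbitDimensionBound_iff_optimal.1 hO n hn)

/-! ## §2 Load-bearing analysis -/

/-- The crux WITHOUT its hypothesis `IsAffineDetRepr (per_n) A`: the conclusion at every size.
[folklore] -/
def OrbitDimensionBoundWithoutRepHyp : Prop :=
  ∀ n : ℕ, 3 ≤ n → ∀ m : ℕ, Concl n m

/-- **The representation hypothesis is load-bearing**: without it the statement fails at
`(n, m) = (3, 6)`, because `dc(per₃) ≥ 7` (Alper–Bogart–Velasco, tree) leaves no size-`6`
representation at all, symmetric or not. [folklore] -/
theorem orbitDimensionBound_false_without_repHyp : ¬ OrbitDimensionBoundWithoutRepHyp := by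
  intro h
  obtain ⟨B, r, Λ, -, -, hB⟩ := h 3 le_rfl 6
  have h7 := AlperBogartVelasco.seven_le_determinantalComplexity_perPoly_three ℂ two_ne_zero
  have h6 : determinantalComplexity (perPoly (Fin 3) ℂ) ≤ 6 :=
    determinantalComplexity_le_of_hasDetRepr ⟨B, hB.1⟩
  omega

/-! ### The witness of §4: the twisted Grenet matrix and the homotheties -/

/-- The Koszul-twisted Grenet matrix `(1+V)·G₇·(1+U)` (the witness of
`UlrichPaddedNoTightInfinity_refuted`, stmt-ValiantsHypothesis-5668): rows/columns
`s, u₀, u₁, u₂, v₀, v₁, v₂`; Grenet's `7 × 7` matrix of `per₃` with the extra entries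
`−x₂₀, x₁₀` in column `u₀` and `−x₂₂, x₁₂` in row `v₀`. [folklore] -/
def twistedGrenet : Matrix (Fin 7) (Fin 7) (MvPolynomial (Fin 3 × Fin 3) ℂ) :=
  !![0, X (0,0), X (1,0), X (2,0), 0, 0, 0;
     0, 1, 0, 0, 0, X (2,1), X (1,1);
     0, -X (2,0), 1, 0, X (2,1), 0, X (0,1);
     0, X (1,0), 0, 1, X (1,1), X (0,1), 0;
     X (0,2), 0, 0, 0, 1, -X (2,2), X (1,2);
     X (1,2), 0, 0, 0, 0, 1, 0;
     X (2,2), 0, 0, 0, 0, 0, 1]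

set_option maxHeartbeats 1600000 in
/-- `twistedGrenet` is an affine determinantal representation of `per₃` (the computation of
`UlrichPaddedNoTightInfinity_refuted`: `A · (1+U)⁻¹ · E₁ · E₂` is upper triangular with diagonal
`(per₃, 1, …, 1)`). [folklore] -/
theorem isAffineDetRepr_twistedGrenet : IsAffineDetRepr (perPoly (Fin 3) ℂ) twistedGrenet := by
  obtain ⟨A, hA⟩ : ∃ M : Matrix (Fin 7) (Fin 7) (MvPolynomial (Fin 3 × Fin 3) ℂ), M = twistedGrenet :=
    ⟨_, rfl⟩
  rw [← hA]
  rw [twistedGrenet] at hA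
  obtain ⟨DU, hDU⟩ : ∃ M : Matrix (Fin 7) (Fin 7) (MvPolynomial (Fin 3 × Fin 3) ℂ), M =
      !![1, 0, 0, 0, 0, 0, 0;
         0, 1, 0, 0, 0, 0, 0;
         0, X (2,0), 1, 0, 0, 0, 0;
         0, -X (1,0), 0, 1, 0, 0, 0;
         0, 0, 0, 0, 1, 0, 0;
         0, 0, 0, 0, 0, 1, 0;
         0, 0, 0, 0, 0, 0, 1] := ⟨_, rfl⟩
  obtain ⟨E1, hE1⟩ : ∃ M : Matrix (Fin 7) (Fin 7) (MvPolynomial (Fin 3 × Fin 3) ℂ), M =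
      !![1, 0, 0, 0, 0, 0, 0;
         0, 1, 0, 0, 0, -X (2,1), -X (1,1);
         0, 0, 1, 0, -X (2,1), 0, -X (0,1);
         0, 0, 0, 1, -X (1,1), -X (0,1), 0;
         0, 0, 0, 0, 1, 0, 0;
         0, 0, 0, 0, 0, 1, 0;
         0, 0, 0, 0, 0, 0, 1] := ⟨_, rfl⟩
  obtain ⟨E2, hE2⟩ : ∃ M : Matrix (Fin 7) (Fin 7) (MvPolynomial (Fin 3 × Fin 3) ℂ), M =
      !![1, 0, 0, 0, 0, 0, 0;
         0, 1, 0, 0, 0, 0, 0;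
         0, 0, 1, 0, 0, 0, 0;
         0, 0, 0, 1, 0, 0, 0;
         -X (0,2), 0, 0, 0, 1, 0, 0;
         -X (1,2), 0, 0, 0, 0, 1, 0;
         -X (2,2), 0, 0, 0, 0, 0, 1] := ⟨_, rfl⟩
  obtain ⟨B1, hB1⟩ : ∃ M : Matrix (Fin 7) (Fin 7) (MvPolynomial (Fin 3 × Fin 3) ℂ), M =
      !![0, X (0,0), X (1,0), X (2,0), 0, 0, 0;
         0, 1, 0, 0, 0, X (2,1), X (1,1);
         0, 0, 1, 0, X (2,1), 0, X (0,1);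
         0, 0, 0, 1, X (1,1), X (0,1), 0;
         X (0,2), 0, 0, 0, 1, -X (2,2), X (1,2);
         X (1,2), 0, 0, 0, 0, 1, 0;
         X (2,2), 0, 0, 0, 0, 0, 1] := ⟨_, rfl⟩
  obtain ⟨B2, hB2⟩ : ∃ M : Matrix (Fin 7) (Fin 7) (MvPolynomial (Fin 3 × Fin 3) ℂ), M =
      !![0, X (0,0), X (1,0), X (2,0), -(X (1,0) * X (2,1) + X (2,0) * X (1,1)),
           -(X (0,0) * X (2,1) + X (2,0) * X (0,1)), -(X (0,0) * X (1,1) + X (1,0) * X (0,1));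
         0, 1, 0, 0, 0, 0, 0;
         0, 0, 1, 0, 0, 0, 0;
         0, 0, 0, 1, 0, 0, 0;
         X (0,2), 0, 0, 0, 1, -X (2,2), X (1,2);
         X (1,2), 0, 0, 0, 0, 1, 0;
         X (2,2), 0, 0, 0, 0, 0, 1] := ⟨_, rfl⟩
  obtain ⟨T, hT⟩ : ∃ M : Matrix (Fin 7) (Fin 7) (MvPolynomial (Fin 3 × Fin 3) ℂ), M =
      !![perPoly (Fin 3) ℂ, X (0,0), X (1,0), X (2,0), -(X (1,0) * X (2,1) + X (2,0) * X (1,1)),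
           -(X (0,0) * X (2,1) + X (2,0) * X (0,1)), -(X (0,0) * X (1,1) + X (1,0) * X (0,1));
         0, 1, 0, 0, 0, 0, 0;
         0, 0, 1, 0, 0, 0, 0;
         0, 0, 0, 1, 0, 0, 0;
         0, 0, 0, 0, 1, -X (2,2), X (1,2);
         0, 0, 0, 0, 0, 1, 0;
         0, 0, 0, 0, 0, 0, 1] := ⟨_, rfl⟩
  have p3 : perPoly (Fin 3) ℂ = X (0,0) * (X (1,1) * X (2,2) + X (2,1) * X (1,2))
      + X (1,0) * (X (0,1) * X (2,2) + X (2,1) * X (0,2))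
      + X (2,0) * (X (0,1) * X (1,2) + X (1,1) * X (0,2)) := by
    simp [perPoly, permanent_fin_three, Matrix.mvPolynomialX_apply]
  -- ONE inspection of the 49 entries: the three products, triangularity, degrees
  have big : ∀ i j : Fin 7,
      ((A * DU) i j = B1 i j ∧ (B1 * E1) i j = B2 i j ∧ (B2 * E2) i j = T i j) ∧
      ((i < j → DU i j = 0) ∧ (j < i → E1 i j = 0) ∧ (i < j → E2 i j = 0) ∧ (j < i → T i j = 0)) ∧
      (A i j).totalDegree ≤ 1 := by
    intro i j
    rw [hA, hDU, hE1, hE2, hB1, hB2, hT, p3]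
    fin_cases i <;> fin_cases j <;> refine ⟨⟨?_, ?_, ?_⟩, ⟨?_, ?_, ?_, ?_⟩, ?_⟩ <;>
      simp [Matrix.mul_apply, Fin.sum_univ_seven, totalDegree_X, totalDegree_neg]
    all_goals ring
  have detA : A.det = perPoly (Fin 3) ℂ := by
    have h1 : A * DU = B1 := Matrix.ext fun i j => (big i j).1.1
    have h2 : B1 * E1 = B2 := Matrix.ext fun i j => (big i j).1.2.1
    have h3 : B2 * E2 = T := Matrix.ext fun i j => (big i j).1.2.2
    have dDU : DU.det = 1 := by
      rw [Matrix.det_of_lowerTriangular DU (fun i j hij => (big i j).2.1.1 hij), Fin.prod_univ_seven, hDU]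
      simp
    have dE1 : E1.det = 1 := by
      rw [Matrix.det_of_upperTriangular (M := E1) fun i j hij => (big i j).2.1.2.1 hij,
        Fin.prod_univ_seven, hE1]
      simp
    have dE2 : E2.det = 1 := by
      rw [Matrix.det_of_lowerTriangular E2 (fun i j hij => (big i j).2.1.2.2.1 hij),
        Fin.prod_univ_seven, hE2]
      simp
    have dT : T.det = perPoly (Fin 3) ℂ := by
      rw [Matrix.det_of_upperTriangular (M := T) fun i j hij => (big i j).2.1.2.2.2 hij,
        Fin.prod_univ_seven, hT]
      simp
    have h := congrArg Matrix.det h3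
    rw [← h2, ← h1, Matrix.det_mul, Matrix.det_mul, Matrix.det_mul, dDU, dE1, dE2, dT, mul_one,
      mul_one, mul_one] at h
    exact h
  exact ⟨fun i j => (big i j).2.2, detA⟩

/-- The homothety `x ↦ c·x` of the `n²` variables, written in the generator form of the crux's
subtorus (`d ≡ c`, `e ≡ 1`). [folklore] -/
def homothety (n : ℕ) (c : ℂˣ) : GL (Fin n × Fin n) ℂ :=
  Grenet.diagUnit (fun p : Fin n × Fin n => ((fun _ => c : Fin n → ℂˣ) p.1 : ℂ) * ((fun _ => (1 : ℂˣ)) p.2 : ℂ))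
    (fun _ => by simp)

/-- Two, as a unit of `ℂ`. [folklore] -/
def two : ℂˣ := Units.mk0 (2 : ℂ) two_ne_zero

@[simp] theorem coe_two : ((two : ℂˣ) : ℂ) = 2 := rfl

/-- The coefficient of a variable in the constant `1` vanishes. [folklore] -/
@[simp] theorem coeff_single_one_one (v : Fin 3 × Fin 3) :
    coeff (Finsupp.single v 1) (1 : MvPolynomial (Fin 3 × Fin 3) ℂ) = 0 := by
  rw [← C_1, coeff_C, if_neg]
  exact fun h => one_ne_zero (Finsupp.single_eq_zero.1 h.symm)

/-- **No exact lift of the homothety `x ↦ 2x` for the twisted Grenet matrix.**  If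
`A(2x) = g A(x) h⁻¹` with `g, h ∈ GL₇(ℂ)`, then comparing the constant parts and the coefficients
of `x₀₀, x₁₀, x₂₀` at four entries forces `g₀₀ = 2h₁₁ = g₃₃ = h₃₃` and `g₀₀ = 2h₃₃`, so `g₀₀ = 0`,
and the constant parts give `g₀ⱼ = 0` (`j ≠ 0`): row `0` of `g` vanishes. [folklore] -/
theorem twistedGrenet_no_homothety_lift :
    ¬ ∃ g h : GL (Fin 7) ℂ, Matrix.linSubstEntries (homothety 3 two) twistedGrenet =
      (g : Matrix (Fin 7) (Fin 7) ℂ).map C * twistedGrenet *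
        ((h⁻¹ : GL (Fin 7) ℂ) : Matrix (Fin 7) (Fin 7) ℂ).map C := by
  rintro ⟨g, h, hgh⟩
  have haff : ∀ r c, (twistedGrenet r c).totalDegree ≤ 1 := isAffineDetRepr_twistedGrenet.1
  -- constant parts: `g Λ = Λ h`
  have h0 := mul_constPart_eq_of_linSubstEntries_eq hgh
  -- linear parts: `g A_v = 2 A_v h`
  have hv : ∀ v : Fin 3 × Fin 3, (g : Matrix (Fin 7) (Fin 7) ℂ) * coeffMat twistedGrenet v =
      ((2 : ℂ) • coeffMat twistedGrenet v) * (h : Matrix (Fin 7) (Fin 7) ℂ) := by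
    intro v
    have e := congrArg (fun M => coeffMat M v) hgh
    rw [coeffMat_linSubstEntries _ _ haff, coeffMat_C_mul_mul_C] at e
    have e2 : ∑ i, ((homothety 3 two : GL (Fin 3 × Fin 3) ℂ) : Matrix _ _ ℂ) v i • coeffMat twistedGrenet i =
        (2 : ℂ) • coeffMat twistedGrenet v := by
      rw [Finset.sum_eq_single v]
      · simp [homothety, Grenet.val_diagUnit]
      · intro i _ hi
        simp [homothety, Grenet.val_diagUnit, Matrix.diagonal_apply_ne _ (Ne.symm hi)]
      · simp
    rw [e2] at e
    exact mul_eq_of_eq_mul_mul_inv e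
  set G : Matrix (Fin 7) (Fin 7) ℂ := (g : Matrix (Fin 7) (Fin 7) ℂ) with hG
  set H : Matrix (Fin 7) (Fin 7) ℂ := (h : Matrix (Fin 7) (Fin 7) ℂ) with hH
  -- the five scalar equations
  have e2 : G 0 0 = 2 * H 1 1 := by
    have := congrFun (congrFun (hv (0,0)) 0) 1
    simpa [twistedGrenet, Matrix.mul_apply, Fin.sum_univ_seven, Finsupp.single_eq_single_iff] using this
  have e3 : G 3 3 = 2 * H 1 1 := by
    have := congrFun (congrFun (hv (1,0)) 3) 1
    simpa [twistedGrenet, Matrix.mul_apply, Fin.sum_univ_seven, Finsupp.single_eq_single_iff] using this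
  have e4 : G 0 0 = 2 * H 3 3 := by
    have := congrFun (congrFun (hv (2,0)) 0) 3
    simpa [twistedGrenet, Matrix.mul_apply, Fin.sum_univ_seven, Finsupp.single_eq_single_iff] using this
  have e5 : G 3 3 = H 3 3 := by
    have := congrFun (congrFun h0 3) 3
    simpa [twistedGrenet, Matrix.mul_apply, Fin.sum_univ_seven] using this
  have e1 : ∀ j : Fin 7, j ≠ 0 → G 0 j = 0 := by
    intro j hj
    have := congrFun (congrFun h0 0) j
    fin_cases j
    · exact absurd rfl hj
    all_goals simpa [twistedGrenet, Matrix.mul_apply, Fin.sum_univ_seven] using this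
  have g00 : G 0 0 = 0 := by linear_combination 2 * e2 - 2 * e3 - e4 + 2 * e5
  have hrow : ∀ j : Fin 7, G 0 j = 0 := by
    intro j
    by_cases hj : j = 0
    · rw [hj]; exact g00
    · exact e1 j hj
  have hdet : G.det = 0 := Matrix.det_eq_zero_of_row_eq_zero 0 hrow
  exact (Matrix.isUnits_det_units g).ne_zero hdet


/-- `∏ c^{f k} = c^{Σ f k}` in a commutative group (integer exponents). [folklore] -/
theorem prod_zpow_eq_zpow_sum' {G ι : Type*} [CommGroup G] (c : G) (s : Finset ι) (f : ι → ℤ) :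
    ∏ k ∈ s, c ^ f k = c ^ (∑ k ∈ s, f k) := by
  classical
  induction s using Finset.induction_on with
  | empty => simp
  | insert a s ha ih => rw [Finset.prod_insert ha, Finset.sum_insert ha, ih, _root_.zpow_add]

/-- **Every admissible subtorus contains every homothety**: `(d, e) = (c·𝟙, 𝟙)` satisfies each
relation with zero row-sum. [folklore] -/
theorem homothety_mem_TΛ {n r : ℕ} {Λ : Fin r → (Fin n ⊕ Fin n) → ℤ} (hΛ : Admissible n r Λ)
    (c : ℂˣ) : homothety n c ∈ TΛ n r Λ := by
  refine Subgroup.subset_closure ⟨fun _ => c, fun _ => 1, fun i => ?_, rfl⟩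
  rw [prod_zpow_eq_zpow_sum', prod_zpow_eq_zpow_sum', (hΛ i).1, zpow_zero, _root_.one_zpow,
    mul_one]

/-! ## §3 A necessary condition: homothety symmetrisation at every size -/

/-- `HomothetySymmetrisation`: for `n ≥ 3`, whenever `per_n` has a size-`m` affine determinantal
representation it has one of size `m` admitting EXACT lifts of every homothety `x ↦ c·x`.
(Weaker than the crux; open for `n ≥ 4` exactly where the crux is.) [folklore] -/
def HomothetySymmetrisation : Prop :=
  ∀ n : ℕ, 3 ≤ n → ∀ (m : ℕ) (A : Matrix (Fin m) (Fin m) (MvPolynomial (Fin n × Fin n) ℂ)),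
    IsAffineDetRepr (perPoly (Fin n) ℂ) A →
    ∃ B : Matrix (Fin m) (Fin m) (MvPolynomial (Fin n × Fin n) ℂ),
      IsAffineDetRepr (perPoly (Fin n) ℂ) B ∧
      ∀ c : ℂˣ, ∃ g h : GL (Fin m) ℂ, Matrix.linSubstEntries (homothety n c) B =
        (g : Matrix (Fin m) (Fin m) ℂ).map C * B * ((h⁻¹ : GL (Fin m) ℂ) : Matrix (Fin m) (Fin m) ℂ).map C

/-- **The crux implies homothety symmetrisation** (homotheties lie in every admissible `T_Λ`).
[folklore] -/
theorem homothetySymmetrisation_of_orbitDimensionBound (h : OrbitDimensionBound) :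
    HomothetySymmetrisation := by
  intro n hn m A hA
  obtain ⟨B, r, Λ, -, hΛ, hB⟩ := h n hn m A hA
  exact ⟨B, hB.1, fun c => hB.2 _ (homothety_mem_TΛ hΛ c)⟩

/-- Contrapositive: a size at which NO representation of `per_n` is homothety-symmetric (a
"homothety gap") refutes the crux. [folklore] -/
theorem orbitDimensionBound_false_of_not_homothetySymmetrisation (h : ¬ HomothetySymmetrisation) :
    ¬ OrbitDimensionBound :=
  fun hO => h (homothetySymmetrisation_of_orbitDimensionBound hO)

/-! ## §4 Refuted strengthenings: symmetry cannot be imposed in place -/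

/-- STRENGTHENING 1 (`InPlaceHomothety`): every affine determinantal representation of `per_n`
(`n ≥ 3`) ITSELF admits exact lifts of all homotheties. [folklore] -/
def InPlaceHomothety : Prop :=
  ∀ n : ℕ, 3 ≤ n → ∀ (m : ℕ) (A : Matrix (Fin m) (Fin m) (MvPolynomial (Fin n × Fin n) ℂ)),
    IsAffineDetRepr (perPoly (Fin n) ℂ) A →
    ∀ c : ℂˣ, ∃ g h : GL (Fin m) ℂ, Matrix.linSubstEntries (homothety n c) A =
      (g : Matrix (Fin m) (Fin m) ℂ).map C * A * ((h⁻¹ : GL (Fin m) ℂ) : Matrix (Fin m) (Fin m) ℂ).map C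

/-- **`InPlaceHomothety` is false** — witness the twisted Grenet matrix at `(n, m, c) = (3, 7, 2)`.
[folklore] -/
theorem not_inPlaceHomothety : ¬ InPlaceHomothety := fun h =>
  twistedGrenet_no_homothety_lift (h 3 le_rfl 7 twistedGrenet isAffineDetRepr_twistedGrenet two)

/-- STRENGTHENING 2 (`InPlaceModAdmissible`): every representation is ITSELF `T_Λ`-equivariant for
some admissible `Λ` of SOME rank `r` (no cap on `r`). [folklore] -/
def InPlaceModAdmissible : Prop :=
  ∀ n : ℕ, 3 ≤ n → ∀ (m : ℕ) (A : Matrix (Fin m) (Fin m) (MvPolynomial (Fin n × Fin n) ℂ)),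
    IsAffineDetRepr (perPoly (Fin n) ℂ) A →
    ∃ (r : ℕ) (Λ : Fin r → (Fin n ⊕ Fin n) → ℤ), Admissible n r Λ ∧
      IsEquivariantDetRepr (TΛ n r Λ) (perPoly (Fin n) ℂ) A

/-- **`InPlaceModAdmissible` is false** (every admissible `T_Λ` contains the homothety `x ↦ 2x`,
which does not lift for the twisted Grenet matrix). [folklore] -/
theorem not_inPlaceModAdmissible : ¬ InPlaceModAdmissible := by
  intro h
  obtain ⟨r, Λ, hΛ, hA⟩ := h 3 le_rfl 7 twistedGrenet isAffineDetRepr_twistedGrenet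
  exact twistedGrenet_no_homothety_lift (hA.2 _ (homothety_mem_TΛ hΛ two))

/-- STRENGTHENING 3 (`OrbitDimensionBoundInPlace`): the crux with `B := A` (every representation is
itself admissibly half-torus symmetric, `r ≤ n/2`). [folklore] -/
def OrbitDimensionBoundInPlace : Prop :=
  ∀ n : ℕ, 3 ≤ n → ∀ (m : ℕ) (A : Matrix (Fin m) (Fin m) (MvPolynomial (Fin n × Fin n) ℂ)),
    IsAffineDetRepr (perPoly (Fin n) ℂ) A →
    ∃ (r : ℕ) (Λ : Fin r → (Fin n ⊕ Fin n) → ℤ), r ≤ n / 2 ∧ Admissible n r Λ ∧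
      IsEquivariantDetRepr (TΛ n r Λ) (perPoly (Fin n) ℂ) A

/-- **The in-place crux is false** at `(n, m) = (3, 7) = (3, dc(per₃))`. [folklore] -/
theorem not_orbitDimensionBoundInPlace : ¬ OrbitDimensionBoundInPlace := fun h =>
  not_inPlaceModAdmissible fun n hn m A hA =>
    let ⟨r, Λ, _, hΛ, hE⟩ := h n hn m A hA
    ⟨r, Λ, hΛ, hE⟩

/-- The in-place strengthening does imply the crux (so §4 kills a genuine strengthening, not a
sibling). [folklore] -/
theorem orbitDimensionBound_of_inPlace (h : OrbitDimensionBoundInPlace) : OrbitDimensionBound :=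
  fun n hn m A hA =>
    let ⟨r, Λ, hr, hΛ, hE⟩ := h n hn m A hA
    ⟨A, r, Λ, hr, hΛ, hE⟩

/-! ## §5 The `r = 0` strengthening (full two-sided torus) -/

/-- STRENGTHENING 4 (`OrbitDimensionBoundR0`): the crux with `r = 0`, i.e. a fully
two-sided-torus-equivariant representation at every size `≥ dc(per_n)`.  TRUE at `n = 3`
(`dc(per₃) = 7`, Grenet); EQUIVALENT to Grenet-optimality `dc(per_n) = 2ⁿ − 1` for all `n ≥ 3`
(`orbitDimensionBoundR0_iff_grenetOptimal`) — open, not refutable today. [folklore] -/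
def OrbitDimensionBoundR0 : Prop :=
  ∀ n : ℕ, 3 ≤ n → ∀ (m : ℕ) (A : Matrix (Fin m) (Fin m) (MvPolynomial (Fin n × Fin n) ℂ)),
    IsAffineDetRepr (perPoly (Fin n) ℂ) A →
    ∃ B : Matrix (Fin m) (Fin m) (MvPolynomial (Fin n × Fin n) ℂ),
      IsEquivariantDetRepr (TΛ n 0 Fin.elim0) (perPoly (Fin n) ℂ) B

/-- `r = 0` implies the crux (the empty family of relations is admissible). [folklore] -/
theorem orbitDimensionBound_of_r0 (h : OrbitDimensionBoundR0) : OrbitDimensionBound := by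
  intro n hn m A hA
  obtain ⟨B, hB⟩ := h n hn m A hA
  exact ⟨B, 0, Fin.elim0, Nat.zero_le _, fun i => i.elim0, hB⟩

/-- The stmt-5114 two-sided torus (nonzero scalings `d, e : Fin n → ℂ`) lies in `T_∅ = TΛ n 0`
(units). [folklore] -/
theorem twoSidedTorus_le_TΛ0 (n : ℕ) :
    Subgroup.closure {γ : Matrix.GeneralLinearGroup (Fin n × Fin n) ℂ | ∃ d e : Fin n → ℂ,
        (∀ i, d i ≠ 0) ∧ (∀ j, e j ≠ 0) ∧ (γ : Matrix (Fin n × Fin n) (Fin n × Fin n) ℂ) =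
          Matrix.diagonal (fun p => d p.1 * e p.2)} ≤ TΛ n 0 Fin.elim0 := by
  refine (Subgroup.closure_le _).2 ?_
  rintro γ ⟨d, e, hd, he, hγ⟩
  refine Subgroup.subset_closure ⟨fun i => Units.mk0 (d i) (hd i), fun j => Units.mk0 (e j) (he j),
    fun i => i.elim0, ?_⟩
  rw [hγ]
  rfl

/-- `T_∅ = TΛ n 0` lies in Grenet's torus (arbitrary `d, e : Fin n → ℂ` with invertible product).
[folklore] -/
theorem TΛ0_le_grenetTorus (n : ℕ) :
    TΛ n 0 Fin.elim0 ≤ Subgroup.closure {γ : GL (Fin n × Fin n) ℂ | ∃ d e : Fin n → ℂ,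
        (γ : Matrix (Fin n × Fin n) (Fin n × Fin n) ℂ) = Matrix.diagonal (fun p => d p.1 * e p.2)} := by
  refine (Subgroup.closure_le _).2 ?_
  rintro γ ⟨d, e, -, hγ⟩
  exact Subgroup.subset_closure ⟨fun i => (d i : ℂ), fun j => (e j : ℂ), hγ⟩

/-- **The `r = 0` strengthening is EQUIVALENT to Grenet-optimality for all `n ≥ 3`**:
`OrbitDimensionBoundR0 ↔ ∀ n ≥ 3, dc(per_n) = 2ⁿ − 1`.  (→: an optimal representation made
`T'`-equivariant has size `≥ 2ⁿ − 1` by the PROVED `RigidMinimalReps.TorusBound`, stmt-5114, and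
`≤` is Grenet; ←: Grenet's representation is `T'`-equivariant with exact lifts, pad it.)  So the
full-torus version of the crux is exactly the open question "is Grenet optimal?", undecided already
at `n = 4` (`9 ≤ dc(per₄) ≤ 15`); the crux proper (`r ≤ n/2`) is weaker. [folklore] -/
theorem orbitDimensionBoundR0_iff_grenetOptimal :
    OrbitDimensionBoundR0 ↔ ∀ n : ℕ, 3 ≤ n → determinantalComplexity (perPoly (Fin n) ℂ) = 2 ^ n - 1 := by
  refine ⟨fun h n hn => le_antisymm (determinantalComplexity_perPoly_le_holds ℂ n (by omega)) ?_,
    fun h n hn m A hA => ?_⟩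
  · obtain ⟨A, hA⟩ := hasDetRepr_determinantalComplexity_holds (perPoly (Fin n) ℂ)
    obtain ⟨B, hB⟩ := h n hn _ A hA
    exact Summit.ValiantsHypothesis.ValiantsHypothesis.Theorems.RigidMinimalRepsTorusBound.torusBound_proof
      n hn _ B (hB.anti (twoSidedTorus_le_TΛ0 n))
  · have hle : determinantalComplexity (perPoly (Fin n) ℂ) ≤ m :=
      determinantalComplexity_le_of_hasDetRepr ⟨A, hA⟩
    rw [h n hn] at hle
    obtain ⟨c, hc⟩ := Nat.exists_eq_add_of_le hle
    obtain ⟨B₀, hB₀⟩ := Grenet.hasEquivariantDetRepr_perPoly_twoSidedTorus ℂ (n := n) (by omega)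
    rw [hc]
    exact ⟨padMat c B₀, isEquivariantDetRepr_padMat (hB₀.anti (TΛ0_le_grenetTorus n)) c⟩

/-- In particular the `r = 0` strengthening already forces `dc(per₄) = 15` (open; tree: `9 ≤ dc(per₄) ≤ 15`).
[folklore] -/
theorem dc_per4_eq_of_r0 (h : OrbitDimensionBoundR0) :
    determinantalComplexity (perPoly (Fin 4) ℂ) = 15 :=
  (orbitDimensionBoundR0_iff_grenetOptimal.1 h) 4 (by norm_num)

/-! ## §6 Targets (line `Sketch`, PICKED; line `birth`)

No registered stub is false as typed (see the module docstring): Sketch stubs 1–2 are true and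
provable now, Sketch stub 3 and birth stub 1 carry the crux's open content, birth stubs 2–3 are
known GIT.  Recorded here so the lead does not wait for a disprover verdict on them.  The only
actionable negative for the lines is §4: no line may take `B := A`. -/

end Summit.ValiantsHypothesis.ValiantsHypothesis.Cruxes.OrbitDimensionBound.Disproof

end
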